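import Mathlib
import HarnessLib
import Summits.PneNP.PneNP.Theorems.RamseyUncertifiablePaleySosRungShellBlock

/-!
# The filled-matrix shell, part 3: the constant part is positive definite (crux `PaleySosRung`,
line `weil-patch-transfer`, stub `stub_filledShell`, Step A)

With levels `α_k = κ_k α^k` (`κ_k = 2^{C(k,2)} 8^{k²}`), the constant part
`C[L,R] = α_{|L ∪ R|} 2^{-|L ∖ R|·|R ∖ L|} − α_{|L|} α_{|R|}` satisfies, for `x` supported on
`{1 ≤ |L| ≤ t}` and `(t+1)·2^t κ_{2t} 2^{t²}·α ≤ 1/7`: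
`(4/7) Σ_L α_{|L|} x_L² ≤ Σ_{L,R} x_L x_R C[L,R]` (`constPart_lower`; Newton's forward differences
expand `|L ∩ R| ↦ C` in the binomial basis, `C(|L ∩ R|, s) = #{T : |T| = s, T ⊆ L ∩ R}`, and each
`T` contributes the per-block form of part 2, `T = ∅` absorbing the subtracted square).
-/

set_option linter.dupNamespace false -- `Summit.PneNP.PneNP.…`: summit = sub-problem (D-0017)

namespace Summit.PneNP.PneNP.Theorems.PaleySosRungWeilPatch

open Finset
open scoped fwdDiff

-- The level weight `κ_k = 2^{C(k,2)} · 8^{k²}` (local notation, as in parts 1–2).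
local notation3 "κ[" k "]" => ((2 : ℝ) ^ (Nat.choose k 2) * (8 : ℝ) ^ (k ^ 2))

/-! ### Newton's forward-difference expansion in the binomial basis -/

/-- **Gregory–Newton**: `f e = Σ_{s ≤ e} C(e,s) · Σ_{k ≤ s} (-1)^{s-k} C(s,k) f k` for every real
sequence `f`. [folklore; Mathlib `shift_eq_sum_fwdDiff_iter`, `fwdDiff_iter_eq_sum_shift`] -/
theorem newton_binomial_basis (f : ℕ → ℝ) (e : ℕ) :
    f e = ∑ s ∈ Finset.range (e + 1), (e.choose s : ℝ) *
      ∑ k ∈ Finset.range (s + 1), (-1 : ℝ) ^ (s - k) * (s.choose k : ℝ) * f k := by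
  have h := shift_eq_sum_fwdDiff_iter (h := (1 : ℕ)) f e 0
  simp only [zero_add, smul_eq_mul, mul_one] at h
  rw [h]
  refine Finset.sum_congr rfl fun s _ => ?_
  rw [nsmul_eq_mul]
  congr 1
  rw [fwdDiff_iter_eq_sum_shift (h := (1 : ℕ)) f s 0]
  refine Finset.sum_congr rfl fun k _ => ?_
  simp only [zero_add, smul_eq_mul, mul_one, zsmul_eq_mul, Int.cast_mul, Int.cast_pow,
    Int.cast_neg, Int.cast_one, Int.cast_natCast]

/-- The same expansion with the outer sum extended to any `range (n + 1)` with `e ≤ n`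
(`C(e,s) = 0` for `s > e`). -/
theorem newton_binomial_basis' (f : ℕ → ℝ) {e n : ℕ} (hen : e ≤ n) :
    f e = ∑ s ∈ Finset.range (n + 1), (e.choose s : ℝ) *
      ∑ k ∈ Finset.range (s + 1), (-1 : ℝ) ^ (s - k) * (s.choose k : ℝ) * f k := by
  rw [newton_binomial_basis f e]
  refine Finset.sum_subset (Finset.range_subset_range.2 (by omega)) fun s hs hs' => ?_
  rw [Finset.mem_range] at hs hs'; rw [Nat.choose_eq_zero_of_lt (by omega), Nat.cast_zero, zero_mul]

/-! ### Counting `s`-subsets of `L ∩ R` -/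

/-- `C(|L ∩ R|, s) = Σ_{T ⊆ univ, |T| = s} [T ⊆ L][T ⊆ R]`. -/
theorem choose_card_inter_eq_sum {V : Type*} [Fintype V] [DecidableEq V] (L R : Finset V) (s : ℕ) :
    ((L ∩ R).card.choose s : ℝ) =
      ∑ T ∈ Finset.powersetCard s (Finset.univ : Finset V), (if T ⊆ L ∧ T ⊆ R then (1 : ℝ) else 0) := by
  rw [← Finset.card_powersetCard, Finset.sum_boole]
  congr 1
  congr 1
  ext T
  simp only [Finset.mem_powersetCard, Finset.mem_filter, Finset.subset_inter_iff,
    Finset.subset_univ, true_and]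
  tauto

/-! ### The constant part in binomial-basis form -/

/-- `|L ∪ R| = |L| + |R| - |L ∩ R|`, `|L ∖ R| = |L| - |L ∩ R|`, `|R ∖ L| = |R| - |L ∩ R|`:
the constant-part entry depends only on `(|L|, |R|, |L ∩ R|)`. -/
theorem constEntry_eq {V : Type*} [DecidableEq V] (L R : Finset V) (g : ℕ → ℝ) :
    g (L ∪ R).card / 2 ^ ((L \ R).card * (R \ L).card) =
      g (L.card + R.card - (L ∩ R).card) / 2 ^ ((L.card - (L ∩ R).card) * (R.card - (L ∩ R).card)) := by
  have h2 : (L \ R).card = L.card - (L ∩ R).card := by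
    have := Finset.card_sdiff_add_card_inter L R; omega
  have h3 : (R \ L).card = R.card - (L ∩ R).card := by
    have := Finset.card_sdiff_add_card_inter R L; rw [Finset.inter_comm] at this; omega
  rw [Finset.card_union L R, h2, h3]

/-- Grouping a sum over subsets containing `T` by cardinality: for `f` vanishing on sets of size
`> n`, `Σ_L [T ⊆ L] f(L) g(|L|) = Σ_{i ≤ n} g(i) Σ_L [T ⊆ L][|L| = i] f L`. -/
theorem sum_subset_group_by_card {V : Type*} [Fintype V] [DecidableEq V] (T : Finset V) (n : ℕ)
    (f : Finset V → ℝ) (hf : ∀ L : Finset V, n < L.card → f L = 0) (g : ℕ → ℝ) :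
    ∑ L : Finset V, (if T ⊆ L then f L * g L.card else 0) =
      ∑ i ∈ Finset.range (n + 1), g i *
        ∑ L : Finset V, (if T ⊆ L ∧ L.card = i then f L else 0) := by
  have hpt : ∀ L : Finset V, (if T ⊆ L then f L * g L.card else 0) =
      ∑ i ∈ Finset.range (n + 1), g i * (if T ⊆ L ∧ L.card = i then f L else 0) := by
    intro L
    by_cases hT : T ⊆ L
    · by_cases hL : L.card ≤ n
      · rw [if_pos hT, Finset.sum_eq_single L.card]
        · simp [hT]; ring
        · intro i _ hi
          rw [if_neg (fun h => hi h.2.symm), mul_zero]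
        · intro h; rw [Finset.mem_range] at h; omega
      · rw [if_pos hT, hf L (by omega), zero_mul]
        refine (Finset.sum_eq_zero fun i hi => ?_).symm
        rw [Finset.mem_range] at hi
        rw [if_neg, mul_zero]
        rintro ⟨-, h⟩; omega
    · rw [if_neg hT]
      refine (Finset.sum_eq_zero fun i _ => ?_).symm
      rw [if_neg (fun h => hT h.1), mul_zero]
  rw [Finset.sum_congr rfl fun L _ => hpt L, Finset.sum_comm]
  refine Finset.sum_congr rfl fun i _ => ?_
  rw [Finset.mul_sum]

/-! ### Step A: the constant part dominates `(4/7) Σ_L α_{|L|} x_L²` -/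

/-- **The constant part of the filled matrix is positive definite on the admissible levels.**
For `0 < α ≤ 1` with `(t+1) · 2^t κ_{2t} 2^{t²} · α ≤ 1/7` and every `x` supported on
`{L : 1 ≤ |L| ≤ t}`:
`(4/7) Σ_L κ_{|L|} α^{|L|} x_L² ≤ Σ_{L,R} x_L x_R (κ_{|L∪R|} α^{|L∪R|} 2^{-|L∖R||R∖L|} − κ_{|L|}α^{|L|} κ_{|R|}α^{|R|})`. -/
theorem constPart_lower {V : Type*} [Fintype V] [DecidableEq V] (t : ℕ) {α : ℝ} (hα0 : 0 < α)
    (hα1 : α ≤ 1) (hsmall : ((t : ℝ) + 1) * (2 ^ t * κ[2 * t] * 2 ^ (t ^ 2)) * α ≤ 1 / 7)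
    (x : Finset V → ℝ) (hx0 : x ∅ = 0) (hxt : ∀ L : Finset V, t < L.card → x L = 0) :
    (4 / 7) * ∑ L : Finset V, κ[L.card] * α ^ L.card * x L ^ 2 ≤
      ∑ L : Finset V, ∑ R : Finset V, x L * x R *
        (κ[(L ∪ R).card] * α ^ (L ∪ R).card / 2 ^ ((L \ R).card * (R \ L).card) -
          κ[L.card] * α ^ L.card * (κ[R.card] * α ^ R.card)) := by
  -- the objects
  set lev : ℕ → ℝ := fun n => κ[n] * α ^ n with hlev
  set cc : ℕ → ℕ → ℕ → ℝ := fun i j e => lev (i + j - e) / 2 ^ ((i - e) * (j - e)) with hcc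
  set bb : ℕ → ℕ → ℕ → ℝ := fun i j s => ∑ k ∈ Finset.range (s + 1),
      (-1 : ℝ) ^ (s - k) * (s.choose k : ℝ) * cc i j k with hbb
  set X : Finset V → ℕ → ℝ := fun T i => ∑ L : Finset V, (if T ⊆ L ∧ L.card = i then x L else 0)
    with hX
  set Q : Finset V → ℝ := fun T => ∑ i ∈ Finset.range (t + 1), ∑ j ∈ Finset.range (t + 1),
      bb i j T.card * X T i * X T j with hQ
  have hlev0 : ∀ n, 0 ≤ lev n := fun n => by simp only [hlev]; positivity
  -- (1) the entry in terms of `cc`, and the subtracted square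
  have hentry : ∀ L R : Finset V,
      κ[(L ∪ R).card] * α ^ (L ∪ R).card / 2 ^ ((L \ R).card * (R \ L).card) =
        cc L.card R.card (L ∩ R).card := by
    intro L R
    have h := constEntry_eq L R lev
    simp only [hlev] at h
    simp only [hcc, hlev]
    exact h
  have hRHS : ∑ L : Finset V, ∑ R : Finset V, x L * x R *
        (κ[(L ∪ R).card] * α ^ (L ∪ R).card / 2 ^ ((L \ R).card * (R \ L).card) -
          κ[L.card] * α ^ L.card * (κ[R.card] * α ^ R.card)) =
      (∑ L : Finset V, ∑ R : Finset V, x L * x R * cc L.card R.card (L ∩ R).card) -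
        (∑ L : Finset V, x L * lev L.card) ^ 2 := by
    rw [sq, Finset.sum_mul_sum, ← Finset.sum_sub_distrib]
    refine Finset.sum_congr rfl fun L _ => ?_
    rw [← Finset.sum_sub_distrib]
    refine Finset.sum_congr rfl fun R _ => ?_
    rw [hentry L R]
    simp only [hlev]
    ring
  -- (2) Newton + subset counting: `cc(|L|,|R|,|L ∩ R|) = Σ_T [T ⊆ L][T ⊆ R] bb(|L|,|R|,|T|)`
  have hnewton : ∀ L R : Finset V, cc L.card R.card (L ∩ R).card =
      ∑ T : Finset V, (if T ⊆ L ∧ T ⊆ R then bb L.card R.card T.card else 0) := by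
    intro L R
    have h1 := newton_binomial_basis (cc L.card R.card) (L ∩ R).card
    have h2 := Finset.sum_powerset_apply_card (bb L.card R.card) (x := L ∩ R)
    simp only [nsmul_eq_mul] at h2
    rw [h1, ← Finset.sum_filter]
    have h3 : (Finset.univ.filter fun T : Finset V => T ⊆ L ∧ T ⊆ R) = (L ∩ R).powerset := by
      rw [← Finset.filter_subset_univ]
      congr 1
      ext T
      exact Finset.subset_inter_iff.symm
    rw [h3, h2]
  -- (3) swap the sums: `A = Σ_T Q(T)`
  have hA : ∑ L : Finset V, ∑ R : Finset V, x L * x R * cc L.card R.card (L ∩ R).card =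
      ∑ T : Finset V, Q T := by
    calc ∑ L : Finset V, ∑ R : Finset V, x L * x R * cc L.card R.card (L ∩ R).card
        = ∑ L : Finset V, ∑ R : Finset V, ∑ T : Finset V,
            (if T ⊆ L ∧ T ⊆ R then x L * x R * bb L.card R.card T.card else 0) := by
          refine Finset.sum_congr rfl fun L _ => Finset.sum_congr rfl fun R _ => ?_
          rw [hnewton L R, Finset.mul_sum]
          refine Finset.sum_congr rfl fun T _ => ?_
          split_ifs <;> ring
      _ = ∑ L : Finset V, ∑ T : Finset V, ∑ R : Finset V,
            (if T ⊆ L ∧ T ⊆ R then x L * x R * bb L.card R.card T.card else 0) :=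
          Finset.sum_congr rfl fun L _ => Finset.sum_comm
      _ = ∑ T : Finset V, ∑ L : Finset V, ∑ R : Finset V,
            (if T ⊆ L ∧ T ⊆ R then x L * x R * bb L.card R.card T.card else 0) :=
          Finset.sum_comm
      _ = ∑ T : Finset V, Q T := by
          refine Finset.sum_congr rfl fun T _ => ?_
          -- inner `R`-sum grouped by `|R|`, then the `L`-sum grouped by `|L|`
          have hinner : ∀ L : Finset V, ∑ R : Finset V,
              (if T ⊆ L ∧ T ⊆ R then x L * x R * bb L.card R.card T.card else 0) =
              if T ⊆ L then x L * ∑ j ∈ Finset.range (t + 1), bb L.card j T.card * X T j else 0 := by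
            intro L
            by_cases hTL : T ⊆ L
            · rw [if_pos hTL]
              have h := sum_subset_group_by_card T t x hxt (fun j => bb L.card j T.card)
              have h' : ∑ j ∈ Finset.range (t + 1), bb L.card j T.card * X T j =
                  ∑ R : Finset V, (if T ⊆ R then x R * bb L.card R.card T.card else 0) := by
                simp only [hX]; exact h.symm
              rw [h', Finset.mul_sum]
              refine Finset.sum_congr rfl fun R _ => ?_
              by_cases hTR : T ⊆ R
              · rw [if_pos ⟨hTL, hTR⟩, if_pos hTR]; ring
              · rw [if_neg (fun h => hTR h.2), if_neg hTR, mul_zero]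
            · rw [if_neg hTL]
              exact Finset.sum_eq_zero fun R _ => if_neg fun h => hTL h.1
          rw [Finset.sum_congr rfl fun L _ => hinner L]
          have h := sum_subset_group_by_card T t x hxt
            (fun i => ∑ j ∈ Finset.range (t + 1), bb i j T.card * X T j)
          rw [h]
          simp only [hQ, hX]
          refine Finset.sum_congr rfl fun i _ => ?_
          rw [Finset.sum_mul]
          refine Finset.sum_congr rfl fun j _ => ?_
          ring
  -- (4) vanishing of `X T i` below `|T|` and above `t`
  have hXlow : ∀ (T : Finset V) (i : ℕ), i < T.card → X T i = 0 := by
    intro T i hi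
    simp only [hX]
    refine Finset.sum_eq_zero fun L _ => if_neg ?_
    rintro ⟨hTL, hL⟩
    have := Finset.card_le_card hTL
    omega
  have hXself : ∀ T : Finset V, X T T.card = x T := by
    intro T
    simp only [hX]
    rw [Finset.sum_eq_single T]
    · simp
    · intro L _ hLT
      refine if_neg ?_
      rintro ⟨hTL, hL⟩
      exact hLT (Finset.eq_of_subset_of_card_le hTL hL.le).symm
    · intro h; exact absurd (Finset.mem_univ T) h
  -- (5) the block bound for `1 ≤ |T| ≤ t`
  have hblock : ∀ T : Finset V, 1 ≤ T.card → T.card ≤ t →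
      (4 / 7) * (lev T.card * x T ^ 2) ≤ Q T := by
    intro T hT1 hTt
    set s := T.card with hs
    -- reindex `Q T` to offsets
    have hreidx : Q T = ∑ a ∈ Finset.range (t + 1 - s), ∑ b ∈ Finset.range (t + 1 - s),
        bb (s + a) (s + b) s * X T (s + a) * X T (s + b) := by
      simp only [hQ]
      have hvan : ∀ (F : ℕ → ℝ), (∀ i, i < s → F i = 0) →
          ∑ i ∈ Finset.range (t + 1), F i = ∑ a ∈ Finset.range (t + 1 - s), F (s + a) := by
        intro F hF
        rw [← Finset.sum_Ico_eq_sum_range, eq_comm]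
        refine Finset.sum_subset (fun i hi => ?_) fun i hi hi' => ?_
        · rw [Finset.mem_Ico] at hi; rw [Finset.mem_range]; exact hi.2
        · rw [Finset.mem_range] at hi; rw [Finset.mem_Ico] at hi'
          exact hF i (by omega)
      rw [hvan _ fun i hi => ?_]
      · refine Finset.sum_congr rfl fun a _ => ?_
        rw [hvan _ fun j hj => ?_]
        rw [hXlow T j hj, mul_zero]
      · refine Finset.sum_eq_zero fun j _ => ?_
        rw [hXlow T i hi, mul_zero, zero_mul]
    -- apply the block estimate of part 2
    have hAcard : ((Finset.range (t + 1 - s)).card : ℝ) * (2 ^ s * κ[2 * t] * 2 ^ (t ^ 2)) * α ≤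
        1 / 7 := by
      refine le_trans ?_ hsmall
      rw [Finset.card_range]
      have h1 : ((t + 1 - s : ℕ) : ℝ) ≤ (t : ℝ) + 1 := by
        have : t + 1 - s ≤ t + 1 := Nat.sub_le _ _
        exact_mod_cast this
      have h2 : (2 : ℝ) ^ s ≤ 2 ^ t := pow_le_pow_right₀ (by norm_num) hTt
      have h3 : (0 : ℝ) ≤ κ[2 * t] * 2 ^ (t ^ 2) * α := by positivity
      calc ((t + 1 - s : ℕ) : ℝ) * (2 ^ s * κ[2 * t] * 2 ^ (t ^ 2)) * α
          = ((t + 1 - s : ℕ) : ℝ) * 2 ^ s * (κ[2 * t] * 2 ^ (t ^ 2) * α) := by ring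
        _ ≤ ((t : ℝ) + 1) * 2 ^ t * (κ[2 * t] * 2 ^ (t ^ 2) * α) := by gcongr
        _ = ((t : ℝ) + 1) * (2 ^ t * κ[2 * t] * 2 ^ (t ^ 2)) * α := by ring
    have hB := block_form_lower t s (Finset.range (t + 1 - s))
      (fun a ha => by rw [Finset.mem_range] at ha; omega) hα0 hα1 hAcard (fun a => X T (s + a))
    -- identify the two coefficient families
    have hcoef : ∀ a b : ℕ,
        (∑ k ∈ Finset.range (s + 1), (-1 : ℝ) ^ (s - k) * (s.choose k : ℝ) *
          (κ[a + b + 2 * s - k] * α ^ (a + b + 2 * s - k) / 2 ^ ((a + s - k) * (b + s - k)))) =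
          bb (s + a) (s + b) s := by
      intro a b
      simp only [hbb, hcc, hlev]
      refine Finset.sum_congr rfl fun k _ => ?_
      rw [show s + a + (s + b) - k = a + b + 2 * s - k by omega,
        show s + a - k = a + s - k by omega, show s + b - k = b + s - k by omega]
    simp only [hcoef] at hB
    rw [hreidx]
    refine le_trans ?_ hB
    -- single out the offset `a = 0`
    have h0mem : 0 ∈ Finset.range (t + 1 - s) := Finset.mem_range.2 (by omega)
    have hterm0 : κ[2 * 0 + s] * α ^ (2 * 0 + s) / 2 ^ (0 ^ 2) * X T (s + 0) ^ 2 =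
        lev T.card * x T ^ 2 := by
      simp only [mul_zero, zero_add, pow_zero, ne_eq, OfNat.ofNat_ne_zero, not_false_eq_true,
        zero_pow, div_one, add_zero, hlev]
      rw [hs, hXself T]
    rw [← hterm0]
    refine mul_le_mul_of_nonneg_left ?_ (by norm_num)
    exact Finset.single_le_sum (f := fun a => κ[2 * a + s] * α ^ (2 * a + s) / 2 ^ (a ^ 2) *
      X T (s + a) ^ 2) (fun a _ => by positivity) h0mem
  -- (6) the `T = ∅` block absorbs the subtracted square
  have hempty : (∑ L : Finset V, x L * lev L.card) ^ 2 ≤ Q ∅ := by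
    -- `X ∅ 0 = x ∅ = 0`
    have hX0 : X ∅ 0 = 0 := by
      have h := hXself ∅
      rw [Finset.card_empty] at h
      rw [h, hx0]
    -- the linear form
    have hlin : ∑ L : Finset V, x L * lev L.card = ∑ a ∈ Finset.Ico 1 (t + 1), lev a * X ∅ a := by
      have h := sum_subset_group_by_card (∅ : Finset V) t x hxt lev
      simp only [Finset.empty_subset, true_and, if_true] at h
      simp only [hX, Finset.empty_subset, true_and]
      rw [h, Finset.range_eq_Ico]
      rw [Finset.sum_eq_sum_Ico_succ_bot (by omega : 0 < t + 1)]
      have : X ∅ 0 = ∑ L : Finset V, if L.card = 0 then x L else 0 := by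
        simp only [hX, Finset.empty_subset, true_and]
      rw [← this, hX0, mul_zero, zero_add]
    -- reindex `Q ∅` to `Ico 1 (t+1)`
    have hQ0 : Q ∅ = ∑ a ∈ Finset.Ico 1 (t + 1), ∑ b ∈ Finset.Ico 1 (t + 1),
        bb a b 0 * X ∅ a * X ∅ b := by
      simp only [hQ, Finset.card_empty]
      rw [Finset.range_eq_Ico, Finset.sum_eq_sum_Ico_succ_bot (by omega : 0 < t + 1)]
      rw [show ∑ j ∈ Finset.Ico 0 (t + 1), bb 0 j 0 * X ∅ 0 * X ∅ j = 0 from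
        Finset.sum_eq_zero fun j _ => by rw [hX0, mul_zero, zero_mul], zero_add]
      refine Finset.sum_congr rfl fun a _ => ?_
      rw [Finset.sum_eq_sum_Ico_succ_bot (by omega : 0 < t + 1), hX0, mul_zero, zero_add]
    have hAcard : ((Finset.Ico 1 (t + 1)).card : ℝ) * (2 ^ 0 * κ[2 * t] * 2 ^ (t ^ 2)) * α ≤
        1 / 7 := by
      refine le_trans ?_ hsmall
      rw [Nat.card_Ico, show t + 1 - 1 = t by omega, pow_zero, one_mul]
      have h2 : (1 : ℝ) ≤ 2 ^ t := one_le_pow₀ (by norm_num)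
      have h3 : (0 : ℝ) ≤ κ[2 * t] * 2 ^ (t ^ 2) * α := by positivity
      have ht : (t : ℝ) ≤ (t : ℝ) + 1 := by linarith
      calc (t : ℝ) * (κ[2 * t] * 2 ^ (t ^ 2)) * α = (t : ℝ) * 1 * (κ[2 * t] * 2 ^ (t ^ 2) * α) := by
            ring
        _ ≤ ((t : ℝ) + 1) * 2 ^ t * (κ[2 * t] * 2 ^ (t ^ 2) * α) := by gcongr
        _ = _ := by ring
    have hB := block_form_lower t 0 (Finset.Ico 1 (t + 1))
      (fun a ha => by rw [Finset.mem_Ico] at ha; omega) hα0 hα1 hAcard (fun a => X ∅ a)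
    have hcoef : ∀ a b : ℕ,
        (∑ k ∈ Finset.range (0 + 1), (-1 : ℝ) ^ (0 - k) * ((0 : ℕ).choose k : ℝ) *
          (κ[a + b + 2 * 0 - k] * α ^ (a + b + 2 * 0 - k) / 2 ^ ((a + 0 - k) * (b + 0 - k)))) =
          bb a b 0 := by
      intro a b
      simp only [hbb, hcc, hlev, mul_zero, add_zero]
    simp only [hcoef] at hB
    have hC := aux_shellBlock (Finset.Ico 1 (t + 1)) (fun a ha => (Finset.mem_Ico.1 ha).1) α hα0
      (fun a => X ∅ a)
    have hlin' : ∑ L : Finset V, x L * lev L.card =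
        ∑ a ∈ Finset.Ico 1 (t + 1), κ[a] * α ^ a * X ∅ a := by
      rw [hlin]
    have hdiag : ∑ a ∈ Finset.Ico 1 (t + 1), κ[2 * a + 0] * α ^ (2 * a + 0) / 2 ^ (a ^ 2) * X ∅ a ^ 2 =
        ∑ a ∈ Finset.Ico 1 (t + 1), κ[2 * a] * α ^ (2 * a) / 2 ^ (a ^ 2) * X ∅ a ^ 2 := by
      simp only [add_zero]
    rw [hdiag] at hB
    have hS0 : 0 ≤ ∑ a ∈ Finset.Ico 1 (t + 1), κ[2 * a] * α ^ (2 * a) / 2 ^ (a ^ 2) * X ∅ a ^ 2 :=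
      Finset.sum_nonneg fun a _ => by positivity
    rw [hlin', hQ0]
    linarith
  -- (7) assemble
  rw [hRHS, hA]
  have hsplitT : ∑ T : Finset V, Q T = Q ∅ + ∑ T ∈ (Finset.univ : Finset (Finset V)).erase ∅, Q T := by
    rw [Finset.add_sum_erase _ _ (Finset.mem_univ _)]
  have hsplitW : ∑ L : Finset V, κ[L.card] * α ^ L.card * x L ^ 2 =
      ∑ T ∈ (Finset.univ : Finset (Finset V)).erase ∅, lev T.card * x T ^ 2 := by
    rw [← Finset.add_sum_erase _ _ (Finset.mem_univ ∅), hx0]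
    simp only [hlev]
    ring
  have hW : ∀ T ∈ (Finset.univ : Finset (Finset V)).erase ∅, (4 / 7) * (lev T.card * x T ^ 2) ≤ Q T := by
    intro T hT
    have hne : T ≠ ∅ := Finset.ne_of_mem_erase hT
    have hT1 : 1 ≤ T.card := Finset.card_pos.2 (Finset.nonempty_iff_ne_empty.2 hne)
    rcases le_or_gt T.card t with hTt | hTt
    · exact hblock T hT1 hTt
    · -- `|T| > t`: both sides vanish
      have hQT : Q T = 0 := by
        simp only [hQ]
        refine Finset.sum_eq_zero fun i hi => Finset.sum_eq_zero fun j _ => ?_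
        rw [Finset.mem_range] at hi
        rw [hXlow T i (by omega), mul_zero, zero_mul]
      rw [hQT, hxt T hTt]
      simp
  rw [hsplitT, hsplitW, Finset.mul_sum]
  have hsumW := Finset.sum_le_sum hW
  linarith

end Summit.PneNP.PneNP.Theorems.PaleySosRungWeilPatch

namespace Summit.PneNP.PneNP.Theorems.PaleySosRungWeilPatch

/-- Registered sub-goal `aux_shellConst` of stub `stub_filledShell` (crux stmt-PneNP-9817): Step A
(`constPart_lower`) on `Fin m` with the level weights written out. -/
theorem aux_shellConst : ∀ (m t : ℕ) (α : ℝ), 0 < α → α ≤ 1 →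
    ((t : ℝ) + 1) * (2 ^ t * ((2 : ℝ) ^ ((2 * t).choose 2) * (8 : ℝ) ^ ((2 * t) ^ 2)) * 2 ^ (t ^ 2)) * α ≤
      1 / 7 →
    ∀ (x : Finset (Fin m) → ℝ), x ∅ = 0 → (∀ L : Finset (Fin m), t < L.card → x L = 0) →
      (4 / 7) * ∑ L : Finset (Fin m), ((2 : ℝ) ^ (L.card.choose 2) * (8 : ℝ) ^ (L.card ^ 2)) *
          α ^ L.card * x L ^ 2 ≤
        ∑ L : Finset (Fin m), ∑ R : Finset (Fin m), x L * x R *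
          (((2 : ℝ) ^ ((L ∪ R).card.choose 2) * (8 : ℝ) ^ ((L ∪ R).card ^ 2)) * α ^ (L ∪ R).card /
              2 ^ ((L \ R).card * (R \ L).card) -
            ((2 : ℝ) ^ (L.card.choose 2) * (8 : ℝ) ^ (L.card ^ 2)) * α ^ L.card *
              (((2 : ℝ) ^ (R.card.choose 2) * (8 : ℝ) ^ (R.card ^ 2)) * α ^ R.card)) :=
  fun _ t _ hα0 hα1 hsmall x hx0 hxt => constPart_lower t hα0 hα1 hsmall x hx0 hxt

end Summit.PneNP.PneNP.Theorems.PaleySosRungWeilPatch
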